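import Summits.Ventures.LatticeQCDFlow.Scaling.ResolventLaw
import Summits.Ventures.LatticeQCDFlow.Scaling.CycleEndHubGainConcave

/-!
HONEST FRAMING: exact (Metropolis-corrected) sampling algorithms for lattice gauge theory; figures
of merit are autocorrelation/cost numbers at stated couplings and volumes; no continuum-physics
claim.

# TailTruncation — THE TAIL RESOLVENT IS THE GEOMETRIC MIXTURE OF THE EXACTLY-`j`-ATTEMPT LAWS UP TO A REMAINDER OF MASS `σ^J`; HENCE A CRITERION `G·A + E_{u_X}f + E_{u_Y}f' ≥ m`
# THAT HOLDS FOR EVERY PAIR OF EXACTLY-`j`-ATTEMPT LAWS (`j ≥ 1`) HOLDS FOR THE PAIR OF TAIL LAWS — THE BRIDGE FROM PER-ATTEMPT CERTIFICATES (`Scaling/OneAttemptCertificate` IS `j = 1`)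
# TO THE FINITE-ODDS CRITERION (lean-2 GEN-36, ours)

Venture-side (OURS).  Cell `lqcd-flow` (pub-lqcd), unit `pub-lqcd-lean-2-g36`, 2026-08-29.  Chapter W (item 1 (i) at finite swap odds), file 12.  §1 (one chain): with iterates
`I_0 = κ`, `I_{j+1} = I_jK` and remainders `R_0 = ũ`, `R_{j+1} = R_jK` of the tail resolvent `ũ = (1−σ)κ + σũK`: `R_J = (1−σ)I_J + σR_{J+1}` and the TRUNCATION IDENTITY
`ũ = Σ_{j<J} (1−σ)σ^j I_j + σ^J R_J` (`tail_truncation`); `R_J ≥ 0`, `Σ R_J = Σ ũ` for stochastic `K`.  §2 (two chains, the gain of chapter V file 2): the functional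
`val(u_X,u_Y) = G(u_X,u_Y)·A + Σu_Xf + Σu_Yf'` (`A ≥ 0`) is concave under the diagonal coupled mixture (chapter V file 4), so
`G(ũ_X,ũ_Y) ≥ Σ_{j<J}(1−σ)σ^j·G(I^X_j,I^Y_j) + σ^J·G(R^X_J,R^Y_J)` (`tail_gain_ge_truncated`; the linear parts split exactly, `tail_linear_truncated`); with `val(R^X_J,R^Y_J) ≥ −B` (`G ≥ −1`, `f, f' ≥ 0`: `B = A`) and `val(I^X_j,I^Y_j) ≥ m` for
all `j < J`: `val(ũ_X,ũ_Y) ≥ m − σ^J(m + A)` for every `J`, hence **`val(ũ_X,ũ_Y) ≥ m`** (`tail_val_ge_of_forall`, `σ < 1`).  With `κ = K(z,·)` the `I_j` are the exactly-`(j+1)`-attempt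
laws; `tail_val_ge_partial` keeps the per-attempt values explicit (`val(ũ) ≥ Σ_{j<J}(1−σ)σ^j·val_j − σ^J·A` for every `J`), so NON-UNIFORM per-attempt bounds can be summed
against the geometric weights — the toy of this generation shows this is necessary: with the constant `2K+2` the uniform statement `Q_j ≥ 0` holds at `j = 1` (file 10) but FAILS at
`j = 2` in some states (a super-persistent hub over impersistent levels), while the geometric mixture satisfies it at every `σ` — and the CUMULATIVE sums `Σ_{j≤J}Q_j` are non-negative in every state of every law tried (`qj_cum.py`), which by
`tail_val_ge_of_cumulative` (Abel summation, weights `(1−σ)σ^j` non-increasing) is a `σ`-FREE sufficient condition for the conjecture.  Hypothesis-equations, no definitions.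

## What is proved

* §1 `tail_remainder_step`, **`tail_truncation`**, `tail_iterate_nonneg`, `tail_remainder_nonneg`, `tail_iterate_sum`, `tail_remainder_sum`.
* §2 `tail_linear_truncated`, `geom_partial_sum`, **`tail_gain_ge_truncated`**, **`tail_val_ge_partial`**, **`tail_val_ge_of_forall`**, `abel_weighted_nonneg`,
  **`tail_val_ge_of_cumulative`** (the `σ`-free form: non-negative CUMULATIVE per-attempt surpluses suffice, by Abel summation).

Reading (no numerics implied): reduces the finite-odds criterion for the tail laws to a weighted sum of statements about matrix powers from a common hub.  NOT CLAIMED: those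
statements.  Literature grade (cell rule): OWN, elementary; nothing cited as a fact; no new bib keys.
-/

open Finset

namespace Summit.Ventures.LatticeQCDFlow.Scaling

section TailOne
variable {S : Type*} [Fintype S]
variable {K : S → S → ℝ} {σ : ℝ} {κ ut : S → ℝ} {It Rm : ℕ → S → ℝ}

/-! ## §1 Truncation of one tail resolvent -/

/-- **Remainder step:** `R_J = (1−σ)I_J + σR_{J+1}` (apply `K` `J` times to `ũ = (1−σ)κ + σũK`). [ours] -/
theorem tail_remainder_step (hut : ∀ v, ut v = (1 - σ) * κ v + σ * ∑ h, ut h * K h v)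
    (hIt0 : ∀ v, It 0 v = κ v) (hItS : ∀ j v, It (j + 1) v = ∑ h, It j h * K h v)
    (hRm0 : ∀ v, Rm 0 v = ut v) (hRmS : ∀ j v, Rm (j + 1) v = ∑ h, Rm j h * K h v) :
    ∀ J v, Rm J v = (1 - σ) * It J v + σ * Rm (J + 1) v := by
  intro J
  induction J with
  | zero => intro v; rw [hRm0, hIt0, hRmS]; simp_rw [hRm0]; exact hut v
  | succ n ih =>
      intro v
      rw [hRmS n v, hItS n v, hRmS (n + 1) v]
      simp_rw [hRmS n]
      calc ∑ h, Rm n h * K h v = ∑ h, ((1 - σ) * It n h + σ * Rm (n + 1) h) * K h v := sum_congr rfl fun h _ => by rw [ih h]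
        _ = (1 - σ) * ∑ h, It n h * K h v + σ * ∑ h, Rm (n + 1) h * K h v := by
            rw [mul_sum, mul_sum, ← sum_add_distrib]; exact sum_congr rfl fun h _ => by ring
        _ = (1 - σ) * ∑ h, It n h * K h v + σ * ∑ h, (∑ w, Rm n w * K w h) * K h v := by
            congr 1; congr 1; exact sum_congr rfl fun h _ => by rw [hRmS n h]

/-- **THE TRUNCATION IDENTITY:** `ũ = Σ_{j<J} (1−σ)σ^j·I_j + σ^J·R_J` for every `J`. [ours] -/
theorem tail_truncation (hut : ∀ v, ut v = (1 - σ) * κ v + σ * ∑ h, ut h * K h v)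
    (hIt0 : ∀ v, It 0 v = κ v) (hItS : ∀ j v, It (j + 1) v = ∑ h, It j h * K h v)
    (hRm0 : ∀ v, Rm 0 v = ut v) (hRmS : ∀ j v, Rm (j + 1) v = ∑ h, Rm j h * K h v) :
    ∀ J v, ut v = ∑ j ∈ range J, (1 - σ) * σ ^ j * It j v + σ ^ J * Rm J v := by
  intro J
  induction J with
  | zero => intro v; simp [hRm0]
  | succ n ih =>
      intro v
      rw [ih v, sum_range_succ, tail_remainder_step hut hIt0 hItS hRm0 hRmS n v]
      ring

/-- The iterates are non-negative (`κ ≥ 0`, `K ≥ 0`). [ours] -/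
theorem tail_iterate_nonneg (hK0 : ∀ a b, 0 ≤ K a b) (hκ0 : ∀ v, 0 ≤ κ v)
    (hIt0 : ∀ v, It 0 v = κ v) (hItS : ∀ j v, It (j + 1) v = ∑ h, It j h * K h v) : ∀ j v, 0 ≤ It j v := by
  intro j
  induction j with
  | zero => intro v; rw [hIt0]; exact hκ0 v
  | succ n ih => intro v; rw [hItS]; exact sum_nonneg fun h _ => mul_nonneg (ih h) (hK0 h v)

/-- The remainders are non-negative (`ũ ≥ 0`, `K ≥ 0`). [ours] -/
theorem tail_remainder_nonneg (hK0 : ∀ a b, 0 ≤ K a b) (hut0 : ∀ v, 0 ≤ ut v)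
    (hRm0 : ∀ v, Rm 0 v = ut v) (hRmS : ∀ j v, Rm (j + 1) v = ∑ h, Rm j h * K h v) : ∀ j v, 0 ≤ Rm j v := by
  intro j
  induction j with
  | zero => intro v; rw [hRm0]; exact hut0 v
  | succ n ih => intro v; rw [hRmS]; exact sum_nonneg fun h _ => mul_nonneg (ih h) (hK0 h v)

/-- The iterates keep the mass of `κ` (rows of `K` sum to one). [ours] -/
theorem tail_iterate_sum (hK1 : ∀ a, ∑ b, K a b = 1) (hIt0 : ∀ v, It 0 v = κ v) (hItS : ∀ j v, It (j + 1) v = ∑ h, It j h * K h v) :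
    ∀ j, ∑ v, It j v = ∑ v, κ v := by
  intro j
  induction j with
  | zero => exact sum_congr rfl fun v _ => hIt0 v
  | succ n ih => rw [show (∑ v, It (n + 1) v) = ∑ v, ∑ h, It n h * K h v from sum_congr rfl fun v _ => hItS n v, geomResolvent_mass_K hK1, ih]

/-- The remainders keep the mass of `ũ`. [ours] -/
theorem tail_remainder_sum (hK1 : ∀ a, ∑ b, K a b = 1) (hRm0 : ∀ v, Rm 0 v = ut v) (hRmS : ∀ j v, Rm (j + 1) v = ∑ h, Rm j h * K h v) :
    ∀ j, ∑ v, Rm j v = ∑ v, ut v := by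
  intro j
  induction j with
  | zero => exact sum_congr rfl fun v _ => hRm0 v
  | succ n ih => rw [show (∑ v, Rm (n + 1) v) = ∑ v, ∑ h, Rm n h * K h v from sum_congr rfl fun v _ => hRmS n v, geomResolvent_mass_K hK1, ih]

end TailOne

/-! ## §2 Two chains: the criterion functional of the tail laws from the per-attempt functionals -/

section TailTwo
variable {S : Type*} [Fintype S]
variable {KX KY : S → S → ℝ} {σ : ℝ} {κX κY utX utY : S → ℝ} {ItX RmX ItY RmY : ℕ → S → ℝ} (NX NY : S → ℕ)

/-- Linear functionals of a truncated tail law. [ours] -/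
theorem tail_linear_truncated {K : S → S → ℝ} {κ ut : S → ℝ} {It Rm : ℕ → S → ℝ}
    (hut : ∀ v, ut v = (1 - σ) * κ v + σ * ∑ h, ut h * K h v)
    (hIt0 : ∀ v, It 0 v = κ v) (hItS : ∀ j v, It (j + 1) v = ∑ h, It j h * K h v)
    (hRm0 : ∀ v, Rm 0 v = ut v) (hRmS : ∀ j v, Rm (j + 1) v = ∑ h, Rm j h * K h v) (f : S → ℝ) (J : ℕ) :
    ∑ w, ut w * f w = ∑ j ∈ range J, (1 - σ) * σ ^ j * ∑ w, It j w * f w + σ ^ J * ∑ w, Rm J w * f w := by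
  have hT := tail_truncation hut hIt0 hItS hRm0 hRmS J
  calc ∑ w, ut w * f w = ∑ w, ((∑ j ∈ range J, (1 - σ) * σ ^ j * It j w) + σ ^ J * Rm J w) * f w := sum_congr rfl fun w _ => by rw [hT w]
    _ = ∑ w, ∑ j ∈ range J, (1 - σ) * σ ^ j * It j w * f w + ∑ w, σ ^ J * Rm J w * f w := by
        rw [← sum_add_distrib]; exact sum_congr rfl fun w _ => by rw [add_mul, sum_mul]
    _ = ∑ j ∈ range J, (1 - σ) * σ ^ j * ∑ w, It j w * f w + σ ^ J * ∑ w, Rm J w * f w := by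
        rw [Finset.sum_comm, mul_sum]
        congr 1
        · exact sum_congr rfl fun j _ => by rw [mul_sum]; exact sum_congr rfl fun w _ => by ring
        · exact sum_congr rfl fun w _ => by ring

/-- Partial geometric sums: `Σ_{j<J}(1−σ)σ^j = 1 − σ^J`. [ours] -/
theorem geom_partial_sum (σ : ℝ) : ∀ J : ℕ, ∑ j ∈ range J, (1 - σ) * σ ^ j = 1 - σ ^ J := by
  intro J
  induction J with
  | zero => simp
  | succ n ih => rw [sum_range_succ, ih]; ring

/-- **THE GAIN OF THE TAIL LAWS DOMINATES THE TRUNCATED MIXTURE OF PER-ATTEMPT GAINS** (concavity of the gain under the diagonal coupled mixture, chapter V file 4):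
`G(ũ_X,ũ_Y) ≥ Σ_{j<J}(1−σ)σ^j·G(I^X_j,I^Y_j) + σ^J·G(R^X_J,R^Y_J)` (`0 ≤ σ ≤ 1`). [ours] -/
theorem tail_gain_ge_truncated (hσ0 : 0 ≤ σ) (hσ1 : σ ≤ 1)
    (hutX : ∀ v, utX v = (1 - σ) * κX v + σ * ∑ h, utX h * KX h v)
    (hItX0 : ∀ v, ItX 0 v = κX v) (hItXS : ∀ j v, ItX (j + 1) v = ∑ h, ItX j h * KX h v)
    (hRmX0 : ∀ v, RmX 0 v = utX v) (hRmXS : ∀ j v, RmX (j + 1) v = ∑ h, RmX j h * KX h v)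
    (hutY : ∀ v, utY v = (1 - σ) * κY v + σ * ∑ h, utY h * KY h v)
    (hItY0 : ∀ v, ItY 0 v = κY v) (hItYS : ∀ j v, ItY (j + 1) v = ∑ h, ItY j h * KY h v)
    (hRmY0 : ∀ v, RmY 0 v = utY v) (hRmYS : ∀ j v, RmY (j + 1) v = ∑ h, RmY j h * KY h v) (J : ℕ) :
    ∑ j ∈ range J, (1 - σ) * σ ^ j * (∑ w, ItX j w * (if NY w < NX w then (1 : ℝ) else 0) - ∑ w, ItY j w * (if NY w < NX w then (1 : ℝ) else 0)
          - ∑ w, max (ItY j w - ItX j w) 0 * (if NX w = NY w then (1 : ℝ) else 0))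
      + σ ^ J * (∑ w, RmX J w * (if NY w < NX w then (1 : ℝ) else 0) - ∑ w, RmY J w * (if NY w < NX w then (1 : ℝ) else 0)
          - ∑ w, max (RmY J w - RmX J w) 0 * (if NX w = NY w then (1 : ℝ) else 0))
      ≤ ∑ w, utX w * (if NY w < NX w then (1 : ℝ) else 0) - ∑ w, utY w * (if NY w < NX w then (1 : ℝ) else 0)
          - ∑ w, max (utY w - utX w) 0 * (if NX w = NY w then (1 : ℝ) else 0) := by
  classical
  have hTX := tail_truncation hutX hItX0 hItXS hRmX0 hRmXS J
  have hTY := tail_truncation hutY hItY0 hItYS hRmY0 hRmYS J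
  -- index by `Fin (J+1)`: `i < J` ↦ iterate `i`, `i = J` ↦ remainder
  let wgt : Fin (J + 1) → ℝ := fun i => if (i : ℕ) < J then (1 - σ) * σ ^ (i : ℕ) else σ ^ J
  let UX : Fin (J + 1) → S → ℝ := fun i => if (i : ℕ) < J then ItX i else RmX J
  let UY : Fin (J + 1) → S → ℝ := fun i => if (i : ℕ) < J then ItY i else RmY J
  have hwgt0 : ∀ i, 0 ≤ wgt i := by
    intro i; simp only [wgt]; split_ifs
    · exact mul_nonneg (by linarith) (pow_nonneg hσ0 _)
    · exact pow_nonneg hσ0 J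
  -- splitting sums over `Fin (J+1)`
  have hsplit : ∀ g : Fin (J + 1) → ℝ, ∑ i, wgt i * g i = ∑ i : Fin J, (1 - σ) * σ ^ (i : ℕ) * g (Fin.castSucc i) + σ ^ J * g (Fin.last J) := by
    intro g
    rw [Fin.sum_univ_castSucc]
    congr 1
    · refine sum_congr rfl fun i _ => ?_
      simp [wgt, Fin.is_lt]
    · simp [wgt]
  have hUX : ∀ i : Fin J, UX (Fin.castSucc i) = ItX i := fun i => by simp [UX, Fin.is_lt]
  have hUY : ∀ i : Fin J, UY (Fin.castSucc i) = ItY i := fun i => by simp [UY, Fin.is_lt]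
  have hUXl : UX (Fin.last J) = RmX J := by simp [UX]
  have hUYl : UY (Fin.last J) = RmY J := by simp [UY]
  -- diagonal double sums
  have hdiag : ∀ g : Fin (J + 1) → Fin (J + 1) → ℝ, ∑ i, ∑ i', (if i = i' then wgt i else 0) * g i i' = ∑ i, wgt i * g i i := by
    intro g; refine sum_congr rfl fun i _ => ?_
    simp_rw [ite_mul, zero_mul]; rw [Finset.sum_ite_eq]; simp
  -- the mixtures are the tail laws
  have hmixX : ∀ w, utX w = ∑ i, ∑ i', (if i = i' then wgt i else 0) * UX i w := by
    intro w
    rw [hdiag (fun i _ => UX i w), hsplit (fun i => UX i w)]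
    simp only [hUX, hUXl]
    rw [Fin.sum_univ_eq_sum_range (fun j => (1 - σ) * σ ^ j * ItX j w) J, hTX w]
  have hmixY : ∀ w, utY w = ∑ i, ∑ i', (if i = i' then wgt i else 0) * UY i' w := by
    intro w
    have e : ∀ i : Fin (J + 1), ∑ i', (if i = i' then wgt i else 0) * UY i' w = wgt i * UY i w := by
      intro i; simp_rw [ite_mul, zero_mul]; rw [Finset.sum_ite_eq]; simp
    simp_rw [e]
    rw [hsplit (fun i => UY i w)]
    simp only [hUY, hUYl]
    rw [Fin.sum_univ_eq_sum_range (fun j => (1 - σ) * σ ^ j * ItY j w) J, hTY w]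
  have hG := hubGain_concave NX NY (fun i i' => if i = i' then wgt i else 0) (fun i i' => by split_ifs; exacts [hwgt0 i, le_rfl]) UX UY utX utY hmixX hmixY
  rw [hdiag, hsplit] at hG
  simp only [hUX, hUY, hUXl, hUYl] at hG
  rw [Fin.sum_univ_eq_sum_range (fun j => (1 - σ) * σ ^ j * (∑ w, ItX j w * (if NY w < NX w then (1 : ℝ) else 0) - ∑ w, ItY j w * (if NY w < NX w then (1 : ℝ) else 0)
          - ∑ w, max (ItY j w - ItX j w) 0 * (if NX w = NY w then (1 : ℝ) else 0))) J] at hG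
  exact hG

/-- **THE TAIL FUNCTIONAL AGAINST THE TRUNCATED SUM OF PER-ATTEMPT FUNCTIONALS:** for every `J`,
`val(ũ_X,ũ_Y) ≥ Σ_{j<J}(1−σ)σ^j·val(I^X_j,I^Y_j) − σ^J·A` (`val(u,u') = G(u,u')·A + Σuf + Σu'f'`, `A ≥ 0`, `f,f' ≥ 0`, remainders probability (sub-)vectors). [ours] -/
theorem tail_val_ge_partial (hσ0 : 0 ≤ σ) (hσ1 : σ ≤ 1) {A : ℝ} (hA : 0 ≤ A) {f f' : S → ℝ} (hf0 : ∀ w, 0 ≤ f w) (hf'0 : ∀ w, 0 ≤ f' w)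
    (hutX : ∀ v, utX v = (1 - σ) * κX v + σ * ∑ h, utX h * KX h v)
    (hItX0 : ∀ v, ItX 0 v = κX v) (hItXS : ∀ j v, ItX (j + 1) v = ∑ h, ItX j h * KX h v)
    (hRmX0 : ∀ v, RmX 0 v = utX v) (hRmXS : ∀ j v, RmX (j + 1) v = ∑ h, RmX j h * KX h v)
    (hutY : ∀ v, utY v = (1 - σ) * κY v + σ * ∑ h, utY h * KY h v)
    (hItY0 : ∀ v, ItY 0 v = κY v) (hItYS : ∀ j v, ItY (j + 1) v = ∑ h, ItY j h * KY h v)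
    (hRmY0 : ∀ v, RmY 0 v = utY v) (hRmYS : ∀ j v, RmY (j + 1) v = ∑ h, RmY j h * KY h v)
    (hRX0 : ∀ j w, 0 ≤ RmX j w) (hRY0 : ∀ j w, 0 ≤ RmY j w) (hRY1 : ∀ j, ∑ w, RmY j w = 1) (J : ℕ) :
    ∑ j ∈ range J, (1 - σ) * σ ^ j * ((∑ w, ItX j w * (if NY w < NX w then (1 : ℝ) else 0) - ∑ w, ItY j w * (if NY w < NX w then (1 : ℝ) else 0)
          - ∑ w, max (ItY j w - ItX j w) 0 * (if NX w = NY w then (1 : ℝ) else 0)) * A + ∑ w, ItX j w * f w + ∑ w, ItY j w * f' w) - σ ^ J * A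
      ≤ (∑ w, utX w * (if NY w < NX w then (1 : ℝ) else 0) - ∑ w, utY w * (if NY w < NX w then (1 : ℝ) else 0)
          - ∑ w, max (utY w - utX w) 0 * (if NX w = NY w then (1 : ℝ) else 0)) * A + ∑ w, utX w * f w + ∑ w, utY w * f' w := by
  have hg := mul_le_mul_of_nonneg_right (tail_gain_ge_truncated NX NY hσ0 hσ1 hutX hItX0 hItXS hRmX0 hRmXS hutY hItY0 hItYS hRmY0 hRmYS J) hA
  rw [tail_linear_truncated hutX hItX0 hItXS hRmX0 hRmXS f J, tail_linear_truncated hutY hItY0 hItYS hRmY0 hRmYS f' J]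
  have hGR := hubGain_ge_neg_one NX NY (u := RmX J) (u' := RmY J) (hRX0 J) (hRY0 J) (hRY1 J)
  have h1 : 0 ≤ ∑ w, RmX J w * f w := sum_nonneg fun w _ => mul_nonneg (hRX0 J w) (hf0 w)
  have h2 : 0 ≤ ∑ w, RmY J w * f' w := sum_nonneg fun w _ => mul_nonneg (hRY0 J w) (hf'0 w)
  have hdist : ∑ j ∈ range J, (1 - σ) * σ ^ j * ((∑ w, ItX j w * (if NY w < NX w then (1 : ℝ) else 0) - ∑ w, ItY j w * (if NY w < NX w then (1 : ℝ) else 0)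
          - ∑ w, max (ItY j w - ItX j w) 0 * (if NX w = NY w then (1 : ℝ) else 0)) * A + ∑ w, ItX j w * f w + ∑ w, ItY j w * f' w)
        = (∑ j ∈ range J, (1 - σ) * σ ^ j * (∑ w, ItX j w * (if NY w < NX w then (1 : ℝ) else 0) - ∑ w, ItY j w * (if NY w < NX w then (1 : ℝ) else 0)
          - ∑ w, max (ItY j w - ItX j w) 0 * (if NX w = NY w then (1 : ℝ) else 0))) * A
          + ∑ j ∈ range J, (1 - σ) * σ ^ j * ∑ w, ItX j w * f w + ∑ j ∈ range J, (1 - σ) * σ ^ j * ∑ w, ItY j w * f' w := by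
    rw [sum_mul, ← sum_add_distrib, ← sum_add_distrib]; exact sum_congr rfl fun j _ => by ring
  rw [hdist]
  have hσJ : 0 ≤ σ ^ J := pow_nonneg hσ0 J
  nlinarith [mul_le_mul_of_nonneg_left hGR hσJ, mul_nonneg hσJ h1, mul_nonneg hσJ h2, mul_nonneg hσJ hA]

/-- **PER-ATTEMPT CERTIFICATES GIVE THE TAIL CERTIFICATE:** with `val(u,u') = G(u,u')·A + Σuf + Σu'f'` (`A ≥ 0`, `f, f' ≥ 0`): if `val(I^X_j,I^Y_j) ≥ m` for every `j` and the
remainders are probability (sub-)vectors, then `val(ũ_X,ũ_Y) ≥ m` (`0 ≤ σ < 1`). [ours] -/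
theorem tail_val_ge_of_forall (hσ0 : 0 ≤ σ) (hσ1 : σ < 1) {A m : ℝ} (hA : 0 ≤ A) {f f' : S → ℝ} (hf0 : ∀ w, 0 ≤ f w) (hf'0 : ∀ w, 0 ≤ f' w)
    (hutX : ∀ v, utX v = (1 - σ) * κX v + σ * ∑ h, utX h * KX h v)
    (hItX0 : ∀ v, ItX 0 v = κX v) (hItXS : ∀ j v, ItX (j + 1) v = ∑ h, ItX j h * KX h v)
    (hRmX0 : ∀ v, RmX 0 v = utX v) (hRmXS : ∀ j v, RmX (j + 1) v = ∑ h, RmX j h * KX h v)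
    (hutY : ∀ v, utY v = (1 - σ) * κY v + σ * ∑ h, utY h * KY h v)
    (hItY0 : ∀ v, ItY 0 v = κY v) (hItYS : ∀ j v, ItY (j + 1) v = ∑ h, ItY j h * KY h v)
    (hRmY0 : ∀ v, RmY 0 v = utY v) (hRmYS : ∀ j v, RmY (j + 1) v = ∑ h, RmY j h * KY h v)
    (hRX0 : ∀ j w, 0 ≤ RmX j w) (hRY0 : ∀ j w, 0 ≤ RmY j w) (hRY1 : ∀ j, ∑ w, RmY j w = 1)
    (hval : ∀ j, m ≤ (∑ w, ItX j w * (if NY w < NX w then (1 : ℝ) else 0) - ∑ w, ItY j w * (if NY w < NX w then (1 : ℝ) else 0)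
          - ∑ w, max (ItY j w - ItX j w) 0 * (if NX w = NY w then (1 : ℝ) else 0)) * A + ∑ w, ItX j w * f w + ∑ w, ItY j w * f' w) :
    m ≤ (∑ w, utX w * (if NY w < NX w then (1 : ℝ) else 0) - ∑ w, utY w * (if NY w < NX w then (1 : ℝ) else 0)
          - ∑ w, max (utY w - utX w) 0 * (if NX w = NY w then (1 : ℝ) else 0)) * A + ∑ w, utX w * f w + ∑ w, utY w * f' w := by
  -- the tail functional dominates the truncated mixture for every `J`
  have hJ : ∀ J, (1 - σ ^ J) * m - σ ^ J * A ≤ (∑ w, utX w * (if NY w < NX w then (1 : ℝ) else 0) - ∑ w, utY w * (if NY w < NX w then (1 : ℝ) else 0)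
          - ∑ w, max (utY w - utX w) 0 * (if NX w = NY w then (1 : ℝ) else 0)) * A + ∑ w, utX w * f w + ∑ w, utY w * f' w := by
    intro J
    have ht := tail_val_ge_partial NX NY hσ0 hσ1.le hA hf0 hf'0 hutX hItX0 hItXS hRmX0 hRmXS hutY hItY0 hItYS hRmY0 hRmYS hRX0 hRY0 hRY1 J
    have hsum : (1 - σ ^ J) * m ≤ ∑ j ∈ range J, (1 - σ) * σ ^ j * ((∑ w, ItX j w * (if NY w < NX w then (1 : ℝ) else 0) - ∑ w, ItY j w * (if NY w < NX w then (1 : ℝ) else 0)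
          - ∑ w, max (ItY j w - ItX j w) 0 * (if NX w = NY w then (1 : ℝ) else 0)) * A + ∑ w, ItX j w * f w + ∑ w, ItY j w * f' w) := by
      calc (1 - σ ^ J) * m = ∑ j ∈ range J, (1 - σ) * σ ^ j * m := by rw [← sum_mul, geom_partial_sum]
        _ ≤ _ := sum_le_sum fun j _ => mul_le_mul_of_nonneg_left (hval j) (mul_nonneg (by linarith) (pow_nonneg hσ0 j))
    linarith
  -- let `J → ∞`
  by_contra hlt
  rw [not_le] at hlt
  set v := (∑ w, utX w * (if NY w < NX w then (1 : ℝ) else 0) - ∑ w, utY w * (if NY w < NX w then (1 : ℝ) else 0)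
          - ∑ w, max (utY w - utX w) 0 * (if NX w = NY w then (1 : ℝ) else 0)) * A + ∑ w, utX w * f w + ∑ w, utY w * f' w with hv
  have hden : 0 < |m| + A + 1 := by positivity
  obtain ⟨J, hJlt⟩ := exists_pow_lt_of_lt_one (div_pos (by linarith : 0 < m - v) hden) hσ1
  have h1 : σ ^ J * (|m| + A + 1) < m - v := (lt_div_iff₀ hden).mp hJlt
  have h2 := hJ J
  have h3 : σ ^ J * m ≤ σ ^ J * |m| := mul_le_mul_of_nonneg_left (le_abs_self m) (pow_nonneg hσ0 J)
  nlinarith [pow_nonneg hσ0 J]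

/-- **Abel summation:** if the partial sums of `a` are non-negative and the weights `w` are non-increasing, then `Σ_{j<J} w_j a_j ≥ w_J·Σ_{j<J} a_j ≥ 0`. [ours] -/
theorem abel_weighted_nonneg {w a : ℕ → ℝ} (hw : ∀ j, w (j + 1) ≤ w j) (hS : ∀ J, 0 ≤ ∑ j ∈ range J, a j) :
    ∀ J, w J * ∑ j ∈ range J, a j ≤ ∑ j ∈ range J, w j * a j := by
  intro J
  induction J with
  | zero => simp
  | succ n ih =>
      rw [sum_range_succ, sum_range_succ]
      have h1 : w (n + 1) * (∑ j ∈ range n, a j + a n) ≤ w n * (∑ j ∈ range n, a j + a n) := by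
        have := hS (n + 1); rw [sum_range_succ] at this
        exact mul_le_mul_of_nonneg_right (hw n) this
      nlinarith [ih]

/-- **CUMULATIVE PER-ATTEMPT CERTIFICATES GIVE THE TAIL CERTIFICATE** (the `σ`-free form): if for every `J` the cumulative surplus `Σ_{j<J}(val(I^X_j,I^Y_j) − m)` is non-negative,
then `val(ũ_X,ũ_Y) ≥ m` for every `0 ≤ σ < 1` (Abel summation with the non-increasing weights `(1−σ)σ^j`, then `J → ∞`). [ours] -/
theorem tail_val_ge_of_cumulative (hσ0 : 0 ≤ σ) (hσ1 : σ < 1) {A m : ℝ} (hA : 0 ≤ A) {f f' : S → ℝ} (hf0 : ∀ w, 0 ≤ f w) (hf'0 : ∀ w, 0 ≤ f' w)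
    (hutX : ∀ v, utX v = (1 - σ) * κX v + σ * ∑ h, utX h * KX h v)
    (hItX0 : ∀ v, ItX 0 v = κX v) (hItXS : ∀ j v, ItX (j + 1) v = ∑ h, ItX j h * KX h v)
    (hRmX0 : ∀ v, RmX 0 v = utX v) (hRmXS : ∀ j v, RmX (j + 1) v = ∑ h, RmX j h * KX h v)
    (hutY : ∀ v, utY v = (1 - σ) * κY v + σ * ∑ h, utY h * KY h v)
    (hItY0 : ∀ v, ItY 0 v = κY v) (hItYS : ∀ j v, ItY (j + 1) v = ∑ h, ItY j h * KY h v)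
    (hRmY0 : ∀ v, RmY 0 v = utY v) (hRmYS : ∀ j v, RmY (j + 1) v = ∑ h, RmY j h * KY h v)
    (hRX0 : ∀ j w, 0 ≤ RmX j w) (hRY0 : ∀ j w, 0 ≤ RmY j w) (hRY1 : ∀ j, ∑ w, RmY j w = 1)
    (hcum : ∀ J, 0 ≤ ∑ j ∈ range J, ((∑ w, ItX j w * (if NY w < NX w then (1 : ℝ) else 0) - ∑ w, ItY j w * (if NY w < NX w then (1 : ℝ) else 0)
          - ∑ w, max (ItY j w - ItX j w) 0 * (if NX w = NY w then (1 : ℝ) else 0)) * A + ∑ w, ItX j w * f w + ∑ w, ItY j w * f' w - m)) :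
    m ≤ (∑ w, utX w * (if NY w < NX w then (1 : ℝ) else 0) - ∑ w, utY w * (if NY w < NX w then (1 : ℝ) else 0)
          - ∑ w, max (utY w - utX w) 0 * (if NX w = NY w then (1 : ℝ) else 0)) * A + ∑ w, utX w * f w + ∑ w, utY w * f' w := by
  set vJ : ℕ → ℝ := fun j => (∑ w, ItX j w * (if NY w < NX w then (1 : ℝ) else 0) - ∑ w, ItY j w * (if NY w < NX w then (1 : ℝ) else 0)
          - ∑ w, max (ItY j w - ItX j w) 0 * (if NX w = NY w then (1 : ℝ) else 0)) * A + ∑ w, ItX j w * f w + ∑ w, ItY j w * f' w with hvJ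
  have hJ : ∀ J, (1 - σ ^ J) * m - σ ^ J * A ≤ (∑ w, utX w * (if NY w < NX w then (1 : ℝ) else 0) - ∑ w, utY w * (if NY w < NX w then (1 : ℝ) else 0)
          - ∑ w, max (utY w - utX w) 0 * (if NX w = NY w then (1 : ℝ) else 0)) * A + ∑ w, utX w * f w + ∑ w, utY w * f' w := by
    intro J
    have ht := tail_val_ge_partial NX NY hσ0 hσ1.le hA hf0 hf'0 hutX hItX0 hItXS hRmX0 hRmXS hutY hItY0 hItYS hRmY0 hRmYS hRX0 hRY0 hRY1 J
    -- Abel: `Σ_{j<J} (1−σ)σ^j (v_j − m) ≥ 0`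
    have hab := abel_weighted_nonneg (w := fun j => (1 - σ) * σ ^ j) (a := fun j => vJ j - m)
      (fun j => by
        have : σ ^ (j + 1) ≤ σ ^ j := by rw [pow_succ]; exact mul_le_of_le_one_right (pow_nonneg hσ0 j) hσ1.le
        exact mul_le_mul_of_nonneg_left this (by linarith))
      (fun J' => by have := hcum J'; simpa [hvJ] using this) J
    have hw0 : 0 ≤ (1 - σ) * σ ^ J * ∑ j ∈ range J, (vJ j - m) :=
      mul_nonneg (mul_nonneg (by linarith) (pow_nonneg hσ0 J)) (by have := hcum J; simpa [hvJ] using this)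
    have hab' : 0 ≤ ∑ j ∈ range J, (1 - σ) * σ ^ j * (vJ j - m) := le_trans hw0 hab
    have hsplit : ∑ j ∈ range J, (1 - σ) * σ ^ j * (vJ j - m) = ∑ j ∈ range J, (1 - σ) * σ ^ j * vJ j - (1 - σ ^ J) * m := by
      rw [← geom_partial_sum σ J, sum_mul, ← sum_sub_distrib]; exact sum_congr rfl fun j _ => by ring
    have hge : (1 - σ ^ J) * m ≤ ∑ j ∈ range J, (1 - σ) * σ ^ j * vJ j := by linarith [hab', hsplit]
    simp only [hvJ] at hge
    linarith
  -- let `J → ∞`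
  by_contra hlt
  rw [not_le] at hlt
  set v := (∑ w, utX w * (if NY w < NX w then (1 : ℝ) else 0) - ∑ w, utY w * (if NY w < NX w then (1 : ℝ) else 0)
          - ∑ w, max (utY w - utX w) 0 * (if NX w = NY w then (1 : ℝ) else 0)) * A + ∑ w, utX w * f w + ∑ w, utY w * f' w with hv
  have hden : 0 < |m| + A + 1 := by positivity
  obtain ⟨J, hJlt⟩ := exists_pow_lt_of_lt_one (div_pos (by linarith : 0 < m - v) hden) hσ1
  have h1 : σ ^ J * (|m| + A + 1) < m - v := (lt_div_iff₀ hden).mp hJlt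
  have h2 := hJ J
  have h3 : σ ^ J * m ≤ σ ^ J * |m| := mul_le_mul_of_nonneg_left (le_abs_self m) (pow_nonneg hσ0 J)
  nlinarith [pow_nonneg hσ0 J]

end TailTwo

end Summit.Ventures.LatticeQCDFlow.Scaling
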